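import Literature.Computability.MetaComplexity.DPReconstructionK
import HarnessLib

/-!
# Complexity meta: Hirahara 2021, Thm. 3.12 (`K`-form) for deterministic tests with a numeric parameter

Topic `Literature/Computability/MetaComplexity`, a corollary file of `DPReconstructionK.lean`
(`DPK.Hirahara2021_dpReconstructionK`: the `K`-complexity form of S. Hirahara, *Average-case hardness
of NP from exponential worst-case hardness assumptions*, ECCC TR21-058 / STOC 2021, Thm. 3.12, for
uniform randomized polynomial-time tests with auxiliary input `⟨1ᵗ, b⟩`, relative to the quick
pseudorandom generator of Lemma 3.4). The proof of Thm. 4.2 in the tree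
(`Hirahara2021_languageCompression_of`, `LanguageCompressionFinal.lean`) consumes Thm. 3.12 in the
following shape (`h312K` there): a DETERMINISTIC polynomial-time test `w ↦ [⟨w, 1ᵐ⟩ ∈ D₀]` with one
numeric parameter `m` (the tree's `paramEnc (w, m)`), advantage measured by `dpAdvantage`, and the
conclusion `K^{q(n+k+e+m)}(x) ≤ k + log q(n+k+e+m)`. This file derives exactly that shape:

* `DPK.paramLang D₀` — the re-paired test language `⟨⟨u, b⟩, y⟩ ↦ [⟨y, u⟩ ∈ D₀]`,
  `boolPair_mem_paramLang`, `paramLang_mem_P`;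
* **`DPK.Hirahara2021_dpReconstructionK_param`** — Thm. 3.12 (`K`-form) for the tests
  `w ↦ [⟨w, 1ᵐ⟩ ∈ D₀]`, `D₀ ∈ P`: the instance `t := m`, `b := []`, no extra coins of
  `DPK.Hirahara2021_dpReconstructionK` applied to `paramLang D₀`.

No new definitions beyond the proof device `paramLang`; no named facts.

## References

* S. Hirahara, ECCC TR21-058 (2021), Thm. 3.12 and the remark after it (p. 23), its use on p. 29
  (proof of Thm. 4.2) [Hirahara2021].
-/

noncomputable section

namespace Literature.Computability.MetaComplexity

open _root_.Computability Polynomial Complexity Complexity.Brick Filter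

namespace DPK

/-- Events that agree on the strings of length `ℓ` have the same uniform probability. [folklore] -/
private theorem uniformProb_congr_len {ℓ : ℕ} {E E' : Set (List Bool)}
    (h : ∀ u : List Bool, u.length = ℓ → (u ∈ E ↔ u ∈ E')) : uniformProb ℓ E = uniformProb ℓ E' := by
  classical
  have hf : (Finset.univ.filter fun r : List.Vector Bool ℓ => r.toList ∈ E) =
      Finset.univ.filter fun r : List.Vector Bool ℓ => r.toList ∈ E' :=
    Finset.filter_congr fun r _ => h r.toList (by simp)
  unfold uniformProb
  rw [hf]

/-- The test language with its input re-paired: `⟨⟨u, b⟩, y⟩ ↦ [⟨y, u⟩ ∈ D₀]` (so that the auxiliary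
input `⟨1ᵗ, b⟩` of `Hirahara2021_dpReconstructionK` carries the numeric parameter of a test
`w ↦ [⟨w, 1ᵗ⟩ ∈ D₀]`). [folklore] -/
def paramLang (D₀ : Language Bool) : Language Bool :=
  (fanoutFn sndF (fstF ∘ fstF)) ⁻¹' D₀

/-- Membership in `paramLang`. [folklore] -/
theorem boolPair_mem_paramLang (D₀ : Language Bool) (u b y : List Bool) :
    boolPair (boolPair u b) y ∈ paramLang D₀ ↔ boolPair y u ∈ D₀ := by
  show fanoutFn sndF (fstF ∘ fstF) (boolPair (boolPair u b) y) ∈ D₀ ↔ _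
  simp only [fanoutFn_apply, Function.comp_apply, fstF_boolPair, sndF_boolPair]

/-- `paramLang D₀ ∈ P` for `D₀ ∈ P`. [folklore] -/
theorem paramLang_mem_P {D₀ : Language Bool} (hD₀ : D₀ ∈ Classes.P) : paramLang D₀ ∈ Classes.P :=
  preimage_mem_P hD₀ (fanoutFn_mem_FP sndF_mem_FP (comp_mem_FP fstF_mem_FP fstF_mem_FP))

/-- **Hirahara 2021, Thm. 3.12 (`K`-complexity form) for deterministic polynomial-time tests with a
numeric parameter** — the shape consumed by the tree's proof of Thm. 4.2
(`Hirahara2021_languageCompression_of`, hypothesis `h312K`), relative to the quick pseudorandom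
generator of Lemma 3.4 (`hPRG`): for every `D₀ ∈ P` there is a polynomial `q` such that for all
`x ∈ {0,1}ⁿ`, `m`, `k`, `e ≥ 1`, if the test `w ↦ [⟨w, 1ᵐ⟩ ∈ D₀]` `1/e`-distinguishes `DP_k(x; z)`
(`z ← {0,1}^{nk}`) from uniform, then `K^{q(N)}(x) ≤ k + log q(N)` with `N = n + k + e + m`.
Instance `t := m`, `b := []`, zero extra coins of `DPK.Hirahara2021_dpReconstructionK` for the
re-paired language `paramLang D₀`. [Hirahara 2021 (ECCC TR21-058), Thm. 3.12 and the remark after it,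
p. 23; used on p. 29] [cite: Hirahara2021, Thm. 3.12] -/
theorem Hirahara2021_dpReconstructionK_param (U : UniversalMachine)
    (hPRG : ∃ (F : List Bool → List Bool) (c : ℕ), F ∈ FP ∧
      ∀ᶠ N in atTop, IsSizePseudorandom (seedGenerator F (c * Nat.log 2 N + c) N))
    {D₀ : Language Bool} (hD₀ : D₀ ∈ Classes.P) :
    ∃ q : Polynomial ℕ, ∀ (x : List Bool) (m k e : ℕ), 1 ≤ e →
      1 / (e : ℝ) ≤ dpAdvantage k x (fun w => D₀.boolIndicator (paramEnc (w, m))) →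
        U.ktAt (q.eval (x.length + k + e + m)) x ≤
          ((k + Nat.log 2 (q.eval (x.length + k + e + m)) : ℕ) : ℕ∞) := by
  classical
  obtain ⟨p, hp⟩ := Hirahara2021_dpReconstructionK U hPRG (paramLang_mem_P hD₀)
  refine ⟨p, fun x m k e he hadv => ?_⟩
  have hN : m + x.length + k + 0 + e + ([] : List Bool).length = x.length + k + e + m := by
    simp only [List.length_nil, Nat.add_zero]; omega
  have h := hp m [] x k 0 e he
  rw [hN] at h
  simp only [List.length_nil, Nat.mul_zero, Nat.add_zero] at h
  refine h ?_
  -- the two advantages coincide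
  have h1 : uniformProb (x.length * k)
        {zr | boolPair (boolPair (unaryEncodeNat m) []) (dpGen k x (zr.take (x.length * k)) ++
          zr.drop (x.length * k)) ∈ paramLang D₀} =
      uniformProb (x.length * k) {z | D₀.boolIndicator (paramEnc (dpGen k x z, m)) = true} := by
    refine uniformProb_congr_len fun u hu => ?_
    simp only [Set.mem_setOf_eq, boolPair_mem_paramLang, paramEnc]
    rw [List.take_of_length_le hu.le, List.drop_of_length_le hu.le, List.append_nil,
      ← Set.mem_iff_boolIndicator]
    rfl
  have h2 : uniformProb (x.length * k + k) {y | boolPair (boolPair (unaryEncodeNat m) []) y ∈ paramLang D₀} =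
      uniformProb (x.length * k + k) {w | D₀.boolIndicator (paramEnc (w, m)) = true} := by
    refine uniformProb_congr_len fun u _ => ?_
    simp only [Set.mem_setOf_eq, boolPair_mem_paramLang, paramEnc]
    rw [← Set.mem_iff_boolIndicator]
    rfl
  rw [h1, h2]
  simpa [dpAdvantage] using hadv

end DPK

end Literature.Computability.MetaComplexity
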